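import Summits.Ventures.CertifiedManyBodySolver.Certificates.HubbardChain_n1_spin_nn
import Literature.MathematicalPhysics.QuantumLattice.HubbardAndersonClusterBound
import Literature.MathematicalPhysics.QuantumLattice.HubbardKineticEnergyDensity
import Literature.MathematicalPhysics.QuantumLattice.HubbardChainEnergyDensityVariationalPrinciple
import Literature.MathematicalPhysics.QuantumLattice.InfVolFermionStateDensity
import HarnessLib

/-!
# Ventures/CertifiedManyBodySolver — Transport/TiltedAndersonCluster.lean

HONEST FRAMING: first certified bounds; not a superconductivity verdict; every number certified or labelled float.

**Soundness of CORRELATOR-TILTED Anderson cluster certificates on translation-invariant states** (the Lean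
half "R3" of sr-mbsolver-m1-5's lever `LEVER-spintilt.md` §1/§5, HOME/INBOX.md l.3520; written by the
pub-mbboot literature seat gen 34 on that written ask, zero compute). Nothing in this file certifies a
matrix: the positive-semidefiniteness hypothesis `hq` below is exactly what a (future) tilt certificate
asserts, and every theorem takes it as a hypothesis.

## Mathematics

Let `Λ' ⊆ ℤ^d` be a finite window, `h(w,v) = andersonCluster Λ' t U w v` the weighted open-cluster operator of
the lane-A rows (`Literature/…/HubbardAndersonClusterBound.lean`: `-t Σ w·K_{x,x+eᵢ} + (U/2) Σ v·[n_x ≠ 1]`),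
`X₀ ∈ 𝔄_{Λ₀}` a FIXED local word (the "tilt word"; m1-5: `X₀ = 𝐒_0·𝐒_{e₁}` = the rows' `spinDotNN1` on
`Λ₀ = nnSupport1 = {0, e₁}`), `w' : ℤ^d → ℝ` tilt weights and `j ∈ ℝ`. The **tilted cluster** is

  `h_j = h(w,v) + j Σ_{y ∈ Λ'} w' y · Γ(τ_y) X₀`        (`tiltedAndersonCluster`; `Γ(τ_y) X₀ = tiltWord`,
                                                          read as `0` when `Λ₀ + y ⊄ Λ'`).

For a TRANSLATION-INVARIANT infinite-volume state `ω` (`InfVolFermionState.IsTranslationInvariant`, the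
tree's predicate) every placed word reads as the word at the origin, `ω(Γ(incl ∘ τ_y) A) = ω(A)`
(compatibility + invariance), so with the bond energies `h_i = ω(Φ{0,eᵢ})`, the on-site energy
`u₀ = ω(Φ{0})` of the Hubbard interaction and the density `ρ = ω(n_{0↑} + n_{0↓})`:

* `ω(clusterHamiltonian Λ' t U J V μ) = Σ_i (Σ_x J̃ x i) h_i + (Σ_x V x) u₀ + (Σ_x μ x) ρ`
  (`IsTranslationInvariant.expect_clusterHamiltonian`; `J̃ = bondWeight`, far endpoint in the window);
* `Re ω(h(w,v)) = e(ω) + (U/2)(1 - ρ)` when `Σ_x w̃ x i = 1` for all `i` and `Σ_x v x = 1`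
  (`….re_expect_andersonCluster_of_cover`; `e(ω) = ω.hubbardEnergyDensity t U = Re(u₀ + Σ_i h_i)` by
  `IsTranslationInvariant.expect_hubbard_meanEnergyObs`);
* `ω(h_j) = ω(h(w,v)) + j (Σ_y w̃' y) ω(X₀)` (`….expect_tiltedAndersonCluster`; `w̃' = tiltWeight`).

States are positive on the cone (`InfVolFermionState.expect_re_nonneg_of_posSemidef`), so a certified floor
`h_j - q·1 ⪰ 0` on the `4^{|Λ'|}`-dimensional cluster Fock space gives, for EVERY translation-invariant `ω`,

  `q ≤ e(ω) + (U/2)(1 - ρ_ω) + j · Re ω(X₀)`     (`IsTranslationInvariant.le_hubbardEnergyDensity_add_tilt`,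
                                                   unit cover sums; general sums: `….le_of_tiltedAndersonCluster`),

hence at density `1` under the energy hypothesis `e(ω) ≤ u` of the correlator rows (D-4):
`j < 0 ⇒ Re ω(X₀) ≤ (u - q)/|j|` and `0 < j ⇒ (q - u)/j ≤ Re ω(X₀)` (companion file,
`….re_expect_le_of_tilt_neg` / `….le_re_expect_of_tilt_pos`). This is m1-5's §1 "CONSEQUENCE" paragraph, proved at the level of
states (no ring sums, no limits), the torus-limit ground states of the rows being translation invariant with
density `1` and energy density `e₀(U)` by tree theorems (`IsTorusLimitOf.isTranslationInvariant`,
`IsTorusLimitOf.density_eq`, `IsTorusLimitOf.hubbardEnergyDensity_eq_hubbardChainEnergyDensity`) — that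
specialisation, in the exact binder shape of `ChainCorrUpperRow` / `ChainCorrLowerRow`, is the companion file
`Transport/TiltedAndersonClusterChain.lean`. State class of the inequality: ALL translation-invariant states
(larger than the torus-limit class (I) of the rows).

## Contents

§1 `placeEmb` (`x ↦ x + y` then isotony), `tiltWord`, `tiltWeight`, `tiltWeightSum`, `tiltedAndersonCluster`
(+ `tiltedAndersonCluster_zero`); §2 `IsTranslationInvariant.expect_fermionEmbed_placeEmb`, `….expect_tiltWord`;
§3 `sum_polySite_eq`, `neg_smul_clusterBondKinetic_eq` (`-t K_{x,x+eᵢ} = Γ(incl) Φ{x,x+eᵢ}`),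
`smul_numberOp_mul_numberOp_eq`, `numberOp_eq_fermionEmbed_nAt`, the TI readings
`….expect_neg_smul_clusterBondKinetic / expect_smul_numberOp_mul_numberOp / expect_numberOp_polySite`,
**`….expect_clusterHamiltonian`**; §4 `re_expect_ge_of_posSemidef_sub_smul_one`, `….expect_andersonCluster`,
`….re_expect_andersonCluster_of_cover`, `….expect_sum_tiltWord`, `….expect_tiltedAndersonCluster`,
**`….le_of_tiltedAndersonCluster`**, **`….le_hubbardEnergyDensity_add_tilt`**. Definitions have bodies; every theorem is proved; no named fact, no sorry; axioms
standard. Dot-notation extensions of the Literature structure `InfVolFermionState` are declared with their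
absolute names (lean/CONVENTIONS.md §2).

## References

* P. W. Anderson, Phys. Rev. 83 (1951) 1260, eq. (2) (cluster lower bounds); R. Valentí, J. Stolze,
  P. J. Hirschfeld, Phys. Rev. B 43 (1991) 13743, §II (weighted clusters) — the `j = 0` substrate
  `HubbardAndersonClusterBound.lean`.
* O. Bratteli, D. W. Robinson, *OAQSM* I §4.3.1 (invariant states), II §6.2.4 (mean energy) — the tree's
  `InfVolFermionState` API; sr-mbsolver-m1-5 `LEVER-spintilt.md` §1, §4, §5 R3 and `tiltpre/lean/SpinTiltSketch.lean`
  (statement sketch; its `clusterSpinDot` is `tiltWord_spinDotNN1_eq` of the companion file).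
-/

noncomputable section

namespace Summit.Ventures.CertifiedManyBodySolver.Transport

open Matrix Finset
open Literature.Probability.LatticeModels
open Literature.MathematicalPhysics.QuantumLattice
open Literature.MathematicalPhysics.QuantumLattice.AndersonCluster
open HubbardWave0
open scoped ComplexOrder BigOperators

variable {d : ℕ}

/-! ### §1. Placing a local word at a site of the cluster -/

/-- The embedding `x ↦ x + y` of the support `Λ₀` onto the translate `Λ₀ + y ⊆ Λ'` inside the cluster
window `Λ'` (translation followed by isotony). -/
def placeEmb (Λ' Λ₀ : Finset (Site d)) (y : Site d) (h : shiftSet y Λ₀ ⊆ Λ') : PolySite Λ₀ ↪ PolySite Λ' :=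
  (PolySite.shiftEmb y Λ₀).trans (PolySite.incl h)

/-- `placeEmb` on a site: `x ↦ x + y`. -/
@[simp] theorem placeEmb_pt (Λ' Λ₀ : Finset (Site d)) (y : Site d) (h : shiftSet y Λ₀ ⊆ Λ') (x : Site d)
    (hx : x ∈ Λ₀) :
    placeEmb Λ' Λ₀ y h (PolySite.pt x hx) = PolySite.pt (x + y) (h (PolySite.add_mem_shiftSet y hx)) := rfl

/-- **The tilt word placed at the site `y` of the cluster**: the translate `Γ(τ_y) X₀` of a fixed local word
`X₀ ∈ 𝔄_{Λ₀}`, read in the cluster algebra `𝔄_{Λ'}` when its support `Λ₀ + y` fits into the window, and `0`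
otherwise (open boundary conditions, as for the kinetic bonds of `andersonCluster`). -/
def tiltWord (Λ' Λ₀ : Finset (Site d)) (X₀ : FermionOp Λ₀) (y : Site d) : FermionOp Λ' :=
  if h : shiftSet y Λ₀ ⊆ Λ' then fermionEmbed (placeEmb Λ' Λ₀ y h) X₀ else 0

/-- The effective tilt weight of the site `y`: `w' y` if the translated support fits into the window, else `0`. -/
def tiltWeight (Λ' Λ₀ : Finset (Site d)) (w' : Site d → ℝ) (y : Site d) : ℝ :=
  if shiftSet y Λ₀ ⊆ Λ' then w' y else 0

/-- Total effective tilt weight `Σ_{y ∈ Λ', Λ₀ + y ⊆ Λ'} w' y`. -/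
def tiltWeightSum (Λ' Λ₀ : Finset (Site d)) (w' : Site d → ℝ) : ℝ := ∑ y ∈ Λ', tiltWeight Λ' Λ₀ w' y

/-- **The tilted weighted Anderson cluster** `h_j = h(w,v) + j Σ_{y ∈ Λ'} w' y · Γ(τ_y) X₀`: the Anderson
cluster operator of the lane-A rows (`andersonCluster Λ' t U w v`) plus `j` times a weighted sum of the
translates of one fixed local word `X₀ ∈ 𝔄_{Λ₀}` over the sites of the window (m1-5's spin tilt:
`Λ₀ = {0, e₁} ⊆ ℤ`, `X₀ = 𝐒_0·𝐒_{e₁}` = `spinDotNN1`). -/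
def tiltedAndersonCluster (Λ' : Finset (Site d)) (t U : ℝ) (w : Site d → Fin d → ℝ) (v : Site d → ℝ)
    (j : ℝ) (Λ₀ : Finset (Site d)) (X₀ : FermionOp Λ₀) (w' : Site d → ℝ) : FermionOp Λ' :=
  andersonCluster Λ' t U w v +
    (j : ℂ) • ∑ y : PolySite Λ', ((w' (ofLex y.1) : ℝ) : ℂ) • tiltWord Λ' Λ₀ X₀ (ofLex y.1)

/-- At `j = 0` the tilted cluster is the Anderson cluster operator of the lane-A rows. -/
@[simp] theorem tiltedAndersonCluster_zero (Λ' : Finset (Site d)) (t U : ℝ) (w : Site d → Fin d → ℝ)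
    (v : Site d → ℝ) (Λ₀ : Finset (Site d)) (X₀ : FermionOp Λ₀) (w' : Site d → ℝ) :
    tiltedAndersonCluster Λ' t U w v 0 Λ₀ X₀ w' = andersonCluster Λ' t U w v := by
  rw [tiltedAndersonCluster, Complex.ofReal_zero, zero_smul, add_zero]

/-! ### §2. Translation-invariant states on placed words -/

section Placed

variable {ω : InfVolFermionState d}

/-- **A translation-invariant state reads a placed word as the word at the origin**:
`ω_{Λ'}(Γ(incl ∘ τ_y) X₀) = ω_{Λ₀}(X₀)`. -/
theorem _root_.Literature.MathematicalPhysics.QuantumLattice.InfVolFermionState.IsTranslationInvariant.expect_fermionEmbed_placeEmb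
    (hω : ω.IsTranslationInvariant) {Λ' Λ₀ : Finset (Site d)} (y : Site d) (h : shiftSet y Λ₀ ⊆ Λ')
    (X₀ : FermionOp Λ₀) :
    ω.expect Λ' (fermionEmbed (placeEmb Λ' Λ₀ y h) X₀) = ω.expect Λ₀ X₀ := by
  rw [placeEmb, ← fermionEmbed_fermionEmbed, ω.compatible h, ← InfVolFermionState.shift_expect, hω y]

/-- The expectation of the tilt word at `y` in a translation-invariant state: `ω(X₀)` if the support fits,
else `0`. -/
theorem _root_.Literature.MathematicalPhysics.QuantumLattice.InfVolFermionState.IsTranslationInvariant.expect_tiltWord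
    (hω : ω.IsTranslationInvariant) (Λ' Λ₀ : Finset (Site d)) (X₀ : FermionOp Λ₀) (y : Site d) :
    ω.expect Λ' (tiltWord Λ' Λ₀ X₀ y) = if shiftSet y Λ₀ ⊆ Λ' then ω.expect Λ₀ X₀ else 0 := by
  unfold tiltWord
  by_cases h : shiftSet y Λ₀ ⊆ Λ'
  · rw [dif_pos h, if_pos h, hω.expect_fermionEmbed_placeEmb y h X₀]
  · rw [dif_neg h, if_neg h, map_zero]

end Placed

/-! ### §3. Translation-invariant states on the weighted cluster Hamiltonian -/

section ClusterExpect

/-- Sums over the ordered site set `PolySite Λ'` are sums over the region `Λ'`. -/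
theorem sum_polySite_eq {M : Type*} [AddCommMonoid M] (Λ' : Finset (Site d)) (f : Site d → M) :
    ∑ y : PolySite Λ', f (ofLex y.1) = ∑ x ∈ Λ', f x := by
  conv_rhs => rw [← map_univ_polySiteEmb Λ', Finset.sum_map]
  rfl

variable {Λ' : Finset (Site d)} (t U : ℝ)

/-- The bond `{x, x + eᵢ}` of a window site whose far endpoint lies in the window is a sub-region. -/
theorem pair_subset_of_mem {x : Site d} (hx : x ∈ Λ') {i : Fin d} (h : x + unitVec i ∈ Λ') :
    ({x, x + unitVec i} : Finset (Site d)) ⊆ Λ' :=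
  insert_subset hx (singleton_subset_iff.2 h)

/-- **The weighted kinetic bond is the embedded Hubbard bond term**: `-t · K_{x,x+eᵢ} = Γ(incl) Φ{x, x+eᵢ}`
(far endpoint in the window). -/
theorem neg_smul_clusterBondKinetic_eq (y : PolySite Λ') (i : Fin d) (h : ofLex y.1 + unitVec i ∈ Λ') :
    -(t : ℂ) • clusterBondKinetic Λ' y i =
      fermionEmbed (PolySite.incl (pair_subset_of_mem (PolySite.ofLex_mem y) h))
        ((hubbardFermionInteraction d t U).Φ {ofLex y.1, ofLex y.1 + unitVec i}) := by
  rw [clusterBondKinetic, dif_pos h, hubbardFermionInteraction_apply_pair, fermionEmbed_smul, fermionEmbed_sum]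
  congr 1
  refine Finset.sum_congr rfl fun σ _ => ?_
  rw [fermionEmbed_add, fermionEmbed_mul, fermionEmbed_mul, fermionEmbed_conjTranspose,
    fermionEmbed_conjTranspose, fermionEmbed_incl_cAt, fermionEmbed_incl_cAt]
  rfl

/-- **The weighted interaction term is the embedded on-site Hubbard term**: `U n_{x↑}n_{x↓} = Γ(incl) Φ{x}`. -/
theorem smul_numberOp_mul_numberOp_eq (y : PolySite Λ') :
    (U : ℂ) • (numberOp y 0 * numberOp y 1 : FermionOp Λ') =
      fermionEmbed (PolySite.incl (singleton_subset_iff.2 (PolySite.ofLex_mem y)))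
        ((hubbardFermionInteraction d t U).Φ {ofLex y.1}) := by
  rw [hubbardFermionInteraction_apply_singleton, fermionEmbed_smul, fermionEmbed_mul, fermionEmbed_numberOp,
    fermionEmbed_numberOp]
  rfl

/-- The one-site number operators are embedded one-site words. -/
theorem numberOp_eq_fermionEmbed_nAt (y : PolySite Λ') (σ : Fin 2) :
    (numberOp y σ : FermionOp Λ') =
      fermionEmbed (PolySite.incl (singleton_subset_iff.2 (PolySite.ofLex_mem y)))
        (nAt (ofLex y.1) (mem_singleton_self _) σ) := by
  rw [fermionEmbed_numberOp]
  rfl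

variable {ω : InfVolFermionState d}

/-- **TI states on the weighted kinetic bond**: `ω(-t K_{x,x+eᵢ}) = [x+eᵢ ∈ Λ'] · ω(Φ{0, eᵢ})`. -/
theorem _root_.Literature.MathematicalPhysics.QuantumLattice.InfVolFermionState.IsTranslationInvariant.expect_neg_smul_clusterBondKinetic
    (hω : ω.IsTranslationInvariant) (y : PolySite Λ') (i : Fin d) :
    ω.expect Λ' (-(t : ℂ) • clusterBondKinetic Λ' y i) =
      if ofLex y.1 + unitVec i ∈ Λ' then
        ω.expect {0, 0 + unitVec i} ((hubbardFermionInteraction d t U).Φ {0, 0 + unitVec i}) else 0 := by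
  by_cases h : ofLex y.1 + unitVec i ∈ Λ'
  · rw [if_pos h, neg_smul_clusterBondKinetic_eq t U y i h, ω.compatible, hω.expect_hubbard_pair t U]
  · rw [if_neg h, clusterBondKinetic, dif_neg h, smul_zero, map_zero]

/-- **TI states on the weighted interaction term**: `ω(U n_{x↑}n_{x↓}) = ω(Φ{0})`. -/
theorem _root_.Literature.MathematicalPhysics.QuantumLattice.InfVolFermionState.IsTranslationInvariant.expect_smul_numberOp_mul_numberOp
    (hω : ω.IsTranslationInvariant) (y : PolySite Λ') :
    ω.expect Λ' ((U : ℂ) • (numberOp y 0 * numberOp y 1)) =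
      ω.expect {0} ((hubbardFermionInteraction d t U).Φ {0}) := by
  rw [smul_numberOp_mul_numberOp_eq t U y, ω.compatible, hω.expect_hubbard_singleton t U]

/-- **TI states on the one-site densities**: `ω(n_{xσ}) = ω(n_{0σ})`. -/
theorem _root_.Literature.MathematicalPhysics.QuantumLattice.InfVolFermionState.IsTranslationInvariant.expect_numberOp_polySite
    (hω : ω.IsTranslationInvariant) (y : PolySite Λ') (σ : Fin 2) :
    ω.expect Λ' (numberOp y σ) = ω.expect {0} (nAt 0 (mem_singleton_self 0) σ) := by
  rw [numberOp_eq_fermionEmbed_nAt y σ, ω.compatible, hω.expect_nAt_eq_expect_nAt_zero]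

/-- **A translation-invariant state on the weighted cluster Hamiltonian**: with the bond energies
`h_i = ω(Φ{0,eᵢ})`, the on-site energy `u₀ = ω(Φ{0})` and the density `ρ = ω(n_{0↑} + n_{0↓})`,
`ω(h(J,V,μ)) = Σ_i (Σ_x J̃ x i) h_i + (Σ_x V x) u₀ + (Σ_x μ x) ρ` (`J̃ = bondWeight`). -/
theorem _root_.Literature.MathematicalPhysics.QuantumLattice.InfVolFermionState.IsTranslationInvariant.expect_clusterHamiltonian
    (hω : ω.IsTranslationInvariant) (Λ' : Finset (Site d)) (t U : ℝ) (J : Site d → Fin d → ℝ) (V μ : Site d → ℝ) :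
    ω.expect Λ' (clusterHamiltonian Λ' t U J V μ) =
      ∑ i : Fin d, ((bondWeightSum Λ' J i : ℝ) : ℂ) *
          ω.expect {0, 0 + unitVec i} ((hubbardFermionInteraction d t U).Φ {0, 0 + unitVec i}) +
        ((siteWeightSum Λ' V : ℝ) : ℂ) * ω.expect {0} ((hubbardFermionInteraction d t U).Φ {0}) +
        ((siteWeightSum Λ' μ : ℝ) : ℂ) *
          ω.expect {0} (nAt 0 (mem_singleton_self 0) 0 + nAt 0 (mem_singleton_self 0) 1) := by
  rw [clusterHamiltonian, map_add, map_add]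
  congr 1
  · congr 1
    · -- kinetic part
      rw [Finset.smul_sum, map_sum]
      have hy : ∀ y : PolySite Λ', ω.expect Λ' (-(t : ℂ) • ∑ i : Fin d,
          ((J (ofLex y.1) i : ℝ) : ℂ) • clusterBondKinetic Λ' y i) =
          ∑ i : Fin d, ((bondWeight Λ' J (ofLex y.1) i : ℝ) : ℂ) *
            ω.expect {0, 0 + unitVec i} ((hubbardFermionInteraction d t U).Φ {0, 0 + unitVec i}) := by
        intro y
        rw [Finset.smul_sum, map_sum]
        refine Finset.sum_congr rfl fun i _ => ?_
        rw [smul_comm, map_smul, hω.expect_neg_smul_clusterBondKinetic t U y i, smul_eq_mul]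
        unfold AndersonCluster.bondWeight
        by_cases h : ofLex y.1 + unitVec i ∈ Λ'
        · rw [if_pos h, if_pos h]
        · rw [if_neg h, if_neg h, mul_zero, Complex.ofReal_zero, zero_mul]
      simp_rw [hy]
      rw [Finset.sum_comm]
      refine Finset.sum_congr rfl fun i _ => ?_
      rw [← Finset.sum_mul, bondWeightSum, ← sum_polySite_eq Λ' (fun x => bondWeight Λ' J x i),
        Complex.ofReal_sum]
    · -- interaction part
      rw [Finset.smul_sum, map_sum]
      have hy : ∀ y : PolySite Λ', ω.expect Λ' ((U : ℂ) • (((V (ofLex y.1) : ℝ) : ℂ) •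
          (numberOp y 0 * numberOp y 1 : FermionOp Λ'))) =
          ((V (ofLex y.1) : ℝ) : ℂ) * ω.expect {0} ((hubbardFermionInteraction d t U).Φ {0}) := by
        intro y
        rw [smul_comm, map_smul, hω.expect_smul_numberOp_mul_numberOp t U y, smul_eq_mul]
      simp_rw [hy]
      rw [← Finset.sum_mul, siteWeightSum, ← sum_polySite_eq Λ' V, Complex.ofReal_sum]
  · -- chemical-potential part
    rw [map_sum]
    have hy : ∀ y : PolySite Λ', ω.expect Λ' (((μ (ofLex y.1) : ℝ) : ℂ) •
        (numberOp y 0 + numberOp y 1 : FermionOp Λ')) =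
        ((μ (ofLex y.1) : ℝ) : ℂ) * ω.expect {0} (nAt 0 (mem_singleton_self 0) 0 + nAt 0 (mem_singleton_self 0) 1) := by
      intro y
      rw [map_smul, map_add, hω.expect_numberOp_polySite y 0, hω.expect_numberOp_polySite y 1, ← map_add,
        smul_eq_mul]
    simp_rw [hy]
    rw [← Finset.sum_mul, siteWeightSum, ← sum_polySite_eq Λ' μ, Complex.ofReal_sum]

end ClusterExpect

/-! ### §4. The tilted cluster in a translation-invariant state; state-level soundness -/

section Tilted

/-- Scaling the site weights scales their sum. -/
theorem siteWeightSum_const_mul' (Λ' : Finset (Site d)) (c : ℝ) (v : Site d → ℝ) :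
    siteWeightSum Λ' (fun x => c * v x) = c * siteWeightSum Λ' v := by
  rw [siteWeightSum, siteWeightSum, Finset.mul_sum]

/-- **Positivity of states on a certified floor**: `h - q·1 ⪰ 0 ⇒ q ≤ Re ω(h)` for EVERY infinite-volume
state `ω` and every local `h`. -/
theorem re_expect_ge_of_posSemidef_sub_smul_one (ω : InfVolFermionState d) {Λ' : Finset (Site d)}
    {A : FermionOp Λ'} {q : ℝ} (h : (A - (q : ℂ) • (1 : FermionOp Λ')).PosSemidef) :
    q ≤ (ω.expect Λ' A).re := by
  have h0 := ω.expect_re_nonneg_of_posSemidef Λ' h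
  rw [map_sub, map_smul, ω.expect_one, Complex.sub_re, smul_eq_mul, mul_one, Complex.ofReal_re] at h0
  linarith

variable {ω : InfVolFermionState d}

/-- **A translation-invariant state on the Anderson cluster operator** `h(w,v)`:
`ω(h(w,v)) = Σ_i (Σ_x w̃ x i) h_i + (Σ_x v x) (u₀ - (U/2) ρ + U/2)` (`h_i`, `u₀`, `ρ` as in
`expect_clusterHamiltonian`; `andersonCluster_eq`). -/
theorem _root_.Literature.MathematicalPhysics.QuantumLattice.InfVolFermionState.IsTranslationInvariant.expect_andersonCluster
    (hω : ω.IsTranslationInvariant) (Λ' : Finset (Site d)) (t U : ℝ) (w : Site d → Fin d → ℝ) (v : Site d → ℝ) :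
    ω.expect Λ' (andersonCluster Λ' t U w v) =
      ∑ i : Fin d, ((bondWeightSum Λ' w i : ℝ) : ℂ) *
          ω.expect {0, 0 + unitVec i} ((hubbardFermionInteraction d t U).Φ {0, 0 + unitVec i}) +
        ((siteWeightSum Λ' v : ℝ) : ℂ) *
          (ω.expect {0} ((hubbardFermionInteraction d t U).Φ {0}) -
            ((U / 2 : ℝ) : ℂ) * ω.expect {0} (nAt 0 (mem_singleton_self 0) 0 + nAt 0 (mem_singleton_self 0) 1) +
            ((U / 2 : ℝ) : ℂ)) := by
  rw [andersonCluster_eq, map_add, map_smul, ω.expect_one, hω.expect_clusterHamiltonian, siteWeightSum_const_mul']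
  push_cast
  ring

/-- **With unit cover sums the Anderson cluster operator reads the energy density**: for translation-invariant
`ω` with density `ρ`, `Re ω(h(w,v)) = e(ω) + (U/2)(1 - ρ)` when `Σ_x w̃ x i = 1` for every direction and
`Σ_x v x = 1` (`e(ω) = Re(u₀ + Σ_i h_i)`, `IsTranslationInvariant.expect_hubbard_meanEnergyObs`). -/
theorem _root_.Literature.MathematicalPhysics.QuantumLattice.InfVolFermionState.IsTranslationInvariant.re_expect_andersonCluster_of_cover
    (hω : ω.IsTranslationInvariant) {Λ' : Finset (Site d)} (t U : ℝ) {w : Site d → Fin d → ℝ} {v : Site d → ℝ}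
    (hw : ∀ i, bondWeightSum Λ' w i = 1) (hv : siteWeightSum Λ' v = 1) :
    (ω.expect Λ' (andersonCluster Λ' t U w v)).re = ω.hubbardEnergyDensity t U + U / 2 * (1 - ω.density) := by
  rw [hω.expect_andersonCluster, InfVolFermionState.hubbardEnergyDensity, InfVolFermionState.meanEnergy,
    hω.expect_hubbard_meanEnergyObs t U, InfVolFermionState.density, InfVolFermionState.densityAt]
  simp only [hw, hv, Complex.ofReal_one, one_mul, Complex.add_re, Complex.sub_re, Complex.re_sum,
    Complex.re_ofReal_mul, Complex.ofReal_re]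
  ring

/-- **A translation-invariant state on the weighted tilt**: `ω(Σ_y w' y · Γ(τ_y) X₀) = (Σ_y w̃' y) ω(X₀)`. -/
theorem _root_.Literature.MathematicalPhysics.QuantumLattice.InfVolFermionState.IsTranslationInvariant.expect_sum_tiltWord
    (hω : ω.IsTranslationInvariant) (Λ' Λ₀ : Finset (Site d)) (X₀ : FermionOp Λ₀) (w' : Site d → ℝ) :
    ω.expect Λ' (∑ y : PolySite Λ', ((w' (ofLex y.1) : ℝ) : ℂ) • tiltWord Λ' Λ₀ X₀ (ofLex y.1)) =
      ((tiltWeightSum Λ' Λ₀ w' : ℝ) : ℂ) * ω.expect Λ₀ X₀ := by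
  rw [map_sum]
  have hy : ∀ y : PolySite Λ', ω.expect Λ' (((w' (ofLex y.1) : ℝ) : ℂ) • tiltWord Λ' Λ₀ X₀ (ofLex y.1)) =
      ((tiltWeight Λ' Λ₀ w' (ofLex y.1) : ℝ) : ℂ) * ω.expect Λ₀ X₀ := by
    intro y
    rw [map_smul, hω.expect_tiltWord, smul_eq_mul]
    unfold tiltWeight
    by_cases h : shiftSet (ofLex y.1) Λ₀ ⊆ Λ'
    · rw [if_pos h, if_pos h]
    · rw [if_neg h, if_neg h, mul_zero, Complex.ofReal_zero, zero_mul]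
  simp_rw [hy]
  rw [← Finset.sum_mul, tiltWeightSum, ← sum_polySite_eq Λ' (tiltWeight Λ' Λ₀ w'), Complex.ofReal_sum]

/-- **A translation-invariant state on the tilted cluster**: `ω(h_j) = ω(h(w,v)) + j (Σ w̃') ω(X₀)`. -/
theorem _root_.Literature.MathematicalPhysics.QuantumLattice.InfVolFermionState.IsTranslationInvariant.expect_tiltedAndersonCluster
    (hω : ω.IsTranslationInvariant) (Λ' : Finset (Site d)) (t U : ℝ) (w : Site d → Fin d → ℝ) (v : Site d → ℝ)
    (j : ℝ) (Λ₀ : Finset (Site d)) (X₀ : FermionOp Λ₀) (w' : Site d → ℝ) :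
    ω.expect Λ' (tiltedAndersonCluster Λ' t U w v j Λ₀ X₀ w') =
      ω.expect Λ' (andersonCluster Λ' t U w v) + (j : ℂ) * (((tiltWeightSum Λ' Λ₀ w' : ℝ) : ℂ) * ω.expect Λ₀ X₀) := by
  rw [tiltedAndersonCluster, map_add, map_smul, hω.expect_sum_tiltWord, smul_eq_mul]

/-- **SOUNDNESS OF A TILTED CLUSTER CERTIFICATE ON TRANSLATION-INVARIANT STATES (general cover sums).**
If `h_j - q·1 ⪰ 0` on the cluster Fock space, then for every translation-invariant `ω` on `ℤ^d`
`q ≤ Σ_i (Σ_x w̃ x i) Re h_i + (Σ_x v x)(Re u₀ - (U/2) ρ + U/2) + j (Σ_y w̃' y) Re ω(X₀)`. -/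
theorem _root_.Literature.MathematicalPhysics.QuantumLattice.InfVolFermionState.IsTranslationInvariant.le_of_tiltedAndersonCluster
    (hω : ω.IsTranslationInvariant) {Λ' : Finset (Site d)} {t U : ℝ} {w : Site d → Fin d → ℝ} {v : Site d → ℝ}
    {j : ℝ} {Λ₀ : Finset (Site d)} {X₀ : FermionOp Λ₀} {w' : Site d → ℝ} {q : ℝ}
    (hq : (tiltedAndersonCluster Λ' t U w v j Λ₀ X₀ w' - (q : ℂ) • (1 : FermionOp Λ')).PosSemidef) :
    q ≤ ∑ i : Fin d, bondWeightSum Λ' w i *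
          (ω.expect {0, 0 + unitVec i} ((hubbardFermionInteraction d t U).Φ {0, 0 + unitVec i})).re +
        siteWeightSum Λ' v *
          ((ω.expect {0} ((hubbardFermionInteraction d t U).Φ {0})).re - U / 2 * ω.density + U / 2) +
        j * (tiltWeightSum Λ' Λ₀ w' * (ω.expect Λ₀ X₀).re) := by
  have h := re_expect_ge_of_posSemidef_sub_smul_one ω hq
  rw [hω.expect_tiltedAndersonCluster, hω.expect_andersonCluster] at h
  rw [InfVolFermionState.density, InfVolFermionState.densityAt]
  simpa only [Complex.add_re, Complex.sub_re, Complex.re_sum, Complex.re_ofReal_mul, Complex.ofReal_re] using h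

/-- **SOUNDNESS ON TRANSLATION-INVARIANT STATES (unit cover sums).** If the bond weights cover every direction
once, the site weights and the effective tilt weights sum to one, and `h_j - q·1 ⪰ 0`, then for every
translation-invariant `ω` on `ℤ^d` with density `ρ` and energy density `e(ω)`:
`q ≤ e(ω) + (U/2)(1 - ρ) + j · Re ω(X₀)`. -/
theorem _root_.Literature.MathematicalPhysics.QuantumLattice.InfVolFermionState.IsTranslationInvariant.le_hubbardEnergyDensity_add_tilt
    (hω : ω.IsTranslationInvariant) {Λ' : Finset (Site d)} {t U : ℝ} {w : Site d → Fin d → ℝ} {v : Site d → ℝ}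
    {j : ℝ} {Λ₀ : Finset (Site d)} {X₀ : FermionOp Λ₀} {w' : Site d → ℝ} {q : ℝ}
    (hw : ∀ i, bondWeightSum Λ' w i = 1) (hv : siteWeightSum Λ' v = 1) (hw' : tiltWeightSum Λ' Λ₀ w' = 1)
    (hq : (tiltedAndersonCluster Λ' t U w v j Λ₀ X₀ w' - (q : ℂ) • (1 : FermionOp Λ')).PosSemidef) :
    q ≤ ω.hubbardEnergyDensity t U + U / 2 * (1 - ω.density) + j * (ω.expect Λ₀ X₀).re := by
  have h := re_expect_ge_of_posSemidef_sub_smul_one ω hq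
  rw [hω.expect_tiltedAndersonCluster, Complex.add_re, hω.re_expect_andersonCluster_of_cover t U hw hv, hw',
    Complex.ofReal_one, one_mul, Complex.re_ofReal_mul] at h
  exact h

end Tilted

end Summit.Ventures.CertifiedManyBodySolver.Transport

end
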